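import Summits.MatrixMultiplication.MatrixMultiplication.Theorems.AbelianSTPPCensusShapeCertVQFinal
import Summits.MatrixMultiplication.MatrixMultiplication.Theorems.AbelianSTPPCensusShapeCertVQEvalA
import Summits.MatrixMultiplication.MatrixMultiplication.Theorems.AbelianSTPPCensusShapeCertVQEvalB
import Summits.MatrixMultiplication.MatrixMultiplication.Theorems.AbelianSTPPCensusShapeCertVQEvalC
import Summits.MatrixMultiplication.MatrixMultiplication.Theorems.AbelianSTPPCensusShapeCertVQEvalD
import Summits.MatrixMultiplication.MatrixMultiplication.Theorems.AbelianSTPPCensusShapeCertVQEvalE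
import Summits.MatrixMultiplication.MatrixMultiplication.Theorems.AbelianSTPPCensusShapeCertVQEvalF
import Summits.MatrixMultiplication.MatrixMultiplication.Theorems.AbelianSTPPCensusShapeCertVQEvalG
import Summits.MatrixMultiplication.MatrixMultiplication.Theorems.AbelianSTPPCensusShapeCertVQEvalH
import Summits.MatrixMultiplication.MatrixMultiplication.Theorems.AbelianSTPPCensusLeafTE337Closed

/-!
# Rung leaf F-M1.T_E beyond the vP wall — no abelian STPP host of order ≤ 359 beats exponent 5/2

Cell mm-stpp, rung F-M1; successor kernel item VQ-CERT (HOME/mm-stpp-eng-2/energy3/VQ-CERT-SPEC.md) filed in support of the closed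
crux item stmt-MatrixMultiplication-19191; seat mm-stpp-vp-p2 (gen 1).

The vP shape sieve alone stops at order `337` (`noAbelianSTPPHost_250_337`; a beating vP-admissible shape list exists at `338`,
`AbelianSTPPCensusVP.shapeExclusionVP_false_at_338`).  Under the cell's registered successor instrument vQ := vP ∧ E3⁺ — the shape
sieve plus the refined three-room energy rule of eng-2 g4 (`STPPThreeRoomEnergy.three_room_energy_plus`, p491649; shape form
`STPPThreeRoomEnergy.E3pAdm` with soundness `e3pAdm_of_isSTPP`, eng-2 g5 p519811), both KERNEL THEOREMS about every STPP family
in every finite abelian group — the exclusion continues: the vQ certificate checker `ShapeCertVQ.checkQ` (`…ShapeCertVQDefs`,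
soundness `…ShapeCertVQ{Semantics,TablesA,Tables,Budgets,Spec,Bounds,Search}`, bridge `…ShapeCertVQFinal`) passes by
`decide +kernel` at every order `338 ≤ M ≤ 359` (`…ShapeCertVQEvalA`–`H`: one evaluation per order up to `356`, root segments
`ShapeCertVQ.rootSegQ` at `357–359` assembled here by `ShapeCertVQ.checkQ_of_root`; standard axioms, no `native_decide`).
Hence `shapeExclusionVQ_338_359` (shape level: no list with ≥ 2 members satisfying `SieveAdmissibleVP M ∧ E3pAdm M` beats `5/2`
at `338 ≤ M ≤ 359`) and, with the vM/U11-G/U11-P soundness theorems of the closed route `AbelianSTPPCensusVP` (`sieveSound`,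
`u11GSound_holds` = [Gry10] port, `u11PSound`) and `e3pAdm_of_isSTPP`, the named leaf
**`noAbelianSTPPHostUpTo_250_359 : NoAbelianSTPPHostUpTo (5/2) 359`**: for every finite abelian group `H` with `|H| ≤ 359` and
every STPP family `(A_i,B_i,C_i)_{i<N}` in `H`, `Σ_i (|A_i||B_i||C_i|)^{5/6} ≤ |H|`.

WHAT THIS IS NOT: no bound on `ω`; a rung leaf (finite range of a necessary condition), never summit credit; no existence claim;
nothing about orders `≥ 360` (the vQ instrument itself is blind from order `490`, eng-1 j274236; the checker's kernel cost, not a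
surviving list, sets the present bound `359` — seat sizing: verdict EXCLUDED at every sampled order `≤ 440`).
-/

set_option linter.dupNamespace false -- `MatrixMultiplication.MatrixMultiplication` (summit = problem, D-0017)
set_option autoImplicit false

namespace Summit.MatrixMultiplication.MatrixMultiplication.Theorems

open Finset STPPThreeRoomEnergy

/-- vQ certificate check at order `357`, assembled from its three root segments (`…ShapeCertVQEvalG`). -/
theorem ShapeCertVQ.checkQ_357 : ShapeCertVQ.checkQ 357 = true :=
  ShapeCertVQ.checkQ_of_root <| ShapeCertVQ.rootSegQ_append ShapeCertVQ.rootSegQ_357_0 <|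
    ShapeCertVQ.rootSegQ_append ShapeCertVQ.rootSegQ_357_51 <| ShapeCertVQ.rootSegQ_append ShapeCertVQ.rootSegQ_357_2269 <|
    ShapeCertVQ.rootTail_nil (by decide +kernel)

/-- vQ certificate check at order `358`, assembled from its two root segments (`…ShapeCertVQEvalG`). -/
theorem ShapeCertVQ.checkQ_358 : ShapeCertVQ.checkQ 358 = true :=
  ShapeCertVQ.checkQ_of_root <| ShapeCertVQ.rootSegQ_append ShapeCertVQ.rootSegQ_358_0 <|
    ShapeCertVQ.rootSegQ_append ShapeCertVQ.rootSegQ_358_53 <| ShapeCertVQ.rootTail_nil (by decide +kernel)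

/-- vQ certificate check at order `359`, assembled from its three root segments (`…ShapeCertVQEvalH`). -/
theorem ShapeCertVQ.checkQ_359 : ShapeCertVQ.checkQ 359 = true :=
  ShapeCertVQ.checkQ_of_root <| ShapeCertVQ.rootSegQ_append ShapeCertVQ.rootSegQ_359_0 <|
    ShapeCertVQ.rootSegQ_append ShapeCertVQ.rootSegQ_359_49 <| ShapeCertVQ.rootSegQ_append ShapeCertVQ.rootSegQ_359_674 <|
    ShapeCertVQ.rootTail_nil (by decide +kernel)

/-- **The vQ certificate holds at every order `338 ≤ M ≤ 359`** (six kernel-evaluated ranges and the three segmented orders). -/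
theorem ShapeCertVQ.checkQ_338_359 (M : ℕ) (h₁ : 338 ≤ M) (h₂ : M ≤ 359) : ShapeCertVQ.checkQ M = true := by
  rcases Nat.lt_or_ge M 344 with k0 | g0
  · exact ShapeCertVQ.checkQ_338_343 M h₁ (by omega)
  rcases Nat.lt_or_ge M 348 with k1 | g1
  · exact ShapeCertVQ.checkQ_344_347 M g0 (by omega)
  rcases Nat.lt_or_ge M 351 with k2 | g2
  · exact ShapeCertVQ.checkQ_348_350 M g1 (by omega)
  rcases Nat.lt_or_ge M 353 with k3 | g3
  · exact ShapeCertVQ.checkQ_351_352 M g2 (by omega)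
  rcases Nat.lt_or_ge M 355 with k4 | g4
  · exact ShapeCertVQ.checkQ_353_354 M g3 (by omega)
  rcases Nat.lt_or_ge M 357 with k5 | g5
  · exact ShapeCertVQ.checkQ_355_356 M g4 (by omega)
  interval_cases M
  · exact ShapeCertVQ.checkQ_357
  · exact ShapeCertVQ.checkQ_358
  · exact ShapeCertVQ.checkQ_359

/-- **vQ shape exclusion for `T_E` (`τ = 5/2`) at the orders `338 ≤ M ≤ 359`**: no shape list with at least two members that
satisfies the vP sieve system and the E3⁺ condition beats `5/2`. [original] -/
theorem shapeExclusionVQ_338_359 : ∀ (N M : ℕ) (a b c : Fin N → ℕ), 2 ≤ N → 338 ≤ M → M ≤ 359 →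
    SieveAdmissibleVP M a b c → E3pAdm M a b c → ¬ Beats (5 / 2) M a b c :=
  fun N M a b c hN h₁ h₂ =>
    ShapeCertVQ.shapeExclusionVQ_of_checkQ (by omega) (ShapeCertVQ.checkQ_338_359 M h₁ h₂) N a b c hN

/-- **Rung leaf T_E/359 (closed, beyond the vP wall).** No finite abelian group of order at most `359` hosts an STPP family
beating exponent `5/2`: `Σ_i (|A_i||B_i||C_i|)^{5/6} ≤ |H|` for every STPP family in every such `H`. [original] -/
theorem noAbelianSTPPHostUpTo_250_359 : NoAbelianSTPPHostUpTo (5 / 2) 359 := by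
  classical
  refine AbelianTECensus.noAbelianSTPPHostUpTo_of_two (τ := 5 / 2) (by norm_num) (by norm_num) ?_
  intro H _ _ hM N A B C hS hne hN
  by_cases h337 : Fintype.card H ≤ 337
  · exact noAbelianSTPPHost_250_337 H h337 N A B C hS
  · have hadm : SieveAdmissibleVP (Fintype.card H) (fun i => (A i).card) (fun i => (B i).card) (fun i => (C i).card) :=
      ⟨AbelianTECensus.sieveSound H N A B C hS hne, u11GSound_holds H N A B C hS hne,
        fun hp => STPPRepCount.u11PSound H hp N A B C hS hne⟩
    have hE : E3pAdm (Fintype.card H) (fun i => (A i).card) (fun i => (B i).card) (fun i => (C i).card) :=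
      e3pAdm_of_isSTPP hS hne
    have h := shapeExclusionVQ_338_359 N (Fintype.card H) _ _ _ hN (by omega) hM hadm hE
    unfold Beats at h
    push Not at h
    simpa [shapeVol] using h

end Summit.MatrixMultiplication.MatrixMultiplication.Theorems
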